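import Summits.QuantumAdvantage.QuantumAdvantage.Theorems.WalkTwoStepDensePeelFlips

/-!
# (G♯) local engine — `DensePinned p` by INVOLUTION PEELING, 3/5: window arithmetic, fire residues, the odd row, the frame

See `WalkTwoStepDensePeelCylinder` (1/5) for the architecture.  THIS MODULE: §4b C1 (window-pattern prefix arithmetic, the flip at
`τ` lowers `N(τ)` by one), C2 (`aOf` the fire residue `a_h = (r_h − β_h w)/(α_h − β_h)` and `fire_iff`; the live constant `liveC`;
the parity dictionary `odd_sum_toNat_add_iff`; the ODD ROW `exists_odd_fiber`; CRT mod `3p`, `crt3`), C3 (the `Frame` of one lifted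
input and the per-cut status changes under the corner flip: own cut `status_own_pre/post`, `y_own_post_of_const/iff`; co-observers
`status_co_eq_of_alpha_eq_beta`, `status_co_iff`).
-/

namespace Summit.QuantumAdvantage.AdviceFreeQNC0.LocalEngine

open Finset Classical
open Summit.QuantumAdvantage.AdviceFreeQNC0.Coset21.RungG (classOf)

namespace DensePeel

/-! ### §4b The local odd-row criterion (PROVED) -/

section Criterion

variable {p n : ℕ}

/-! #### C1 Window arithmetic and the flip at `τ` (prefix recursion: the tree's `Coset21.wtPrefix_succ`) -/

/-- Under the window pattern, `N(τ) = N(s) + 1` for `s < τ ≤ s + d₀ + 1`. -/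
theorem wtPrefix_of_winPat_left {d₀ τ : ℕ} {u : Fin n → Bool} (hpat : WinPat n d₀ τ u) (hτn : τ ≤ n) {s : ℕ}
    (h1 : s < τ) (h2 : τ ≤ s + d₀ + 1) : wtPrefix u τ = wtPrefix u s + 1 := by
  rw [wtPrefix_eq_add_midCount u h1.le]
  congr 1
  rw [Finset.card_eq_one]
  refine ⟨⟨τ - 1, by omega⟩, ?_⟩
  ext i
  simp only [Finset.mem_filter, Finset.mem_univ, true_and, Finset.mem_singleton]
  constructor
  · rintro ⟨hi1, hi2, hi3⟩
    have := (hpat i (by omega) (by omega)).mp hi3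
    exact Fin.ext (by simp only; omega)
  · intro h
    subst h
    exact ⟨by simp only; omega, by simp only; omega,
      (hpat _ (by simp only; omega) (by simp only; omega)).mpr (by simp only; omega)⟩

/-- Under the window pattern, `N(s) = N(τ)` for `τ ≤ s ≤ τ + d₀ + 1`. -/
theorem wtPrefix_of_winPat_right {d₀ τ : ℕ} {u : Fin n → Bool} (hpat : WinPat n d₀ τ u) {s : ℕ}
    (h1 : τ ≤ s) (h2 : s ≤ τ + d₀ + 1) : wtPrefix u s = wtPrefix u τ := by
  rw [wtPrefix_eq_add_midCount u h1]
  suffices h : ((univ : Finset (Fin n)).filter fun i : Fin n => τ ≤ i.val ∧ i.val < s ∧ u i = true).card = 0 by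
    rw [h, add_zero]
  rw [Finset.card_eq_zero, Finset.filter_eq_empty_iff]
  rintro i - ⟨hi1, hi2, hi3⟩
  have := (hpat i (by omega) (by omega)).mp hi3
  omega

/-- The corner flip at `τ` on the corner `(u_{τ−1}, u_τ) = (1, 0)` lowers `N(τ)` by one. -/
theorem wtPrefix_cornerFlip_self (u : Fin n → Bool) (τ : ℕ) (h1 : 1 ≤ τ) (h2 : τ < n)
    (ha : u ⟨τ - 1, by omega⟩ = true) (hb : u ⟨τ, h2⟩ = false) :
    wtPrefix (cornerFlip n τ u) τ + 1 = wtPrefix u τ := by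
  have hv : cornerFlip n τ u ⟨τ - 1, by omega⟩ = false := by
    unfold cornerFlip
    rw [dif_pos ⟨h1, h2⟩]
    simp only [Function.comp_apply, Equiv.swap_apply_left]
    exact hb
  have e1 := Coset21.wtPrefix_succ (cornerFlip n τ u) (τ - 1) (by omega)
  have e2 := Coset21.wtPrefix_succ u (τ - 1) (by omega)
  rw [Nat.sub_add_cancel h1] at e1 e2
  rw [e1, e2, wtPrefix_cornerFlip τ u (show τ - 1 ≠ τ by omega), hv, if_pos ha]
  simp

/-! #### C2 Algebra, parity and the odd row -/

/-- the fire residue of cut `h` in class `w`: `a_h = (r_h − β_h w)/(α_h − β_h)`. -/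
noncomputable def aOf (S : TwoStep p n) (w : ZMod p) (h : Fin (n + 1)) : ZMod p :=
  (S.r h - S.β h * w) * (S.α h - S.β h)⁻¹

/-- the (constant) live bit of a near co-observer at position `h` in the dead row `e`: `N(h) = N(τ) − [h < τ]`. -/
def liveC (c τ w3 e h : ℕ) : Prop := (c + h + w3 + e + (if h < τ then 2 else 0)) % 3 ≠ 0

/-- A genuine two-step form fires at exactly one residue of `N(s)`. -/
theorem fire_iff [Fact p.Prime] {α β r w ξ : ZMod p} (hαβ : α ≠ β) :
    (α * ξ + β * (w - ξ) = r) ↔ ξ = (r - β * w) * (α - β)⁻¹ := by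
  have hne : α - β ≠ 0 := sub_ne_zero.mpr hαβ
  rw [eq_mul_inv_iff_mul_eq₀ hne]
  constructor
  · intro h
    linear_combination h
  · intro h
    linear_combination h

/-- Parity dictionary: the two status sums have odd total iff an odd number of statuses differ. -/
theorem odd_sum_toNat_add_iff {ι : Type*} (s : Finset ι) (a b : ι → Bool) :
    Odd (∑ i ∈ s, ((a i).toNat + (b i).toNat)) ↔ Odd (s.filter fun i => a i ≠ b i).card := by
  have h : ∀ i, (a i).toNat + (b i).toNat = (if a i ≠ b i then 1 else 0) + 2 * (if (a i && b i) = true then 1 else 0) := by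
    intro i
    cases a i <;> cases b i <;> decide
  rw [Finset.sum_congr rfl (fun i _ => h i), Finset.sum_add_distrib, ← Finset.mul_sum, ← Finset.card_filter,
    ← Finset.card_filter]
  have h2 : Even (2 * (s.filter fun i => (a i && b i) = true).card) := even_two_mul _
  rw [Nat.odd_add]
  exact ⟨fun hh => hh.mpr h2, fun hh => ⟨fun _ => h2, fun _ => hh⟩⟩

/-- **The odd row.** One odd set and otherwise even sets: some point lies in an odd number of them. -/
theorem exists_odd_fiber {ι X : Type*} [Fintype ι] [Fintype X] [DecidableEq ι] [DecidableEq X]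
    (A : ι → Finset X) (i₀ : ι) (hodd : Odd (A i₀).card) (heven : ∀ i, i ≠ i₀ → Even (A i).card) :
    ∃ x : X, Odd ((univ : Finset ι).filter fun i => x ∈ A i).card := by
  by_contra hall
  push Not at hall
  have key : ∑ x : X, ((univ : Finset ι).filter fun i => x ∈ A i).card = ∑ i : ι, (A i).card := by
    simp only [Finset.card_filter]
    rw [Finset.sum_comm]
    refine Finset.sum_congr rfl fun i _ => ?_
    rw [← Finset.card_filter]
    congr 1
    ext x
    simp
  have htot : Odd (∑ i : ι, (A i).card) := by
    rw [← Finset.add_sum_erase _ _ (Finset.mem_univ i₀)]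
    exact hodd.add_even (Finset.even_sum _ fun i hi => heven i (Finset.ne_of_mem_erase hi))
  have hev : Even (∑ x : X, ((univ : Finset ι).filter fun i => x ∈ A i).card) :=
    Finset.even_sum _ fun x _ => Nat.not_odd_iff_even.mp (hall x)
  rw [key] at hev
  exact (Nat.not_even_iff_odd.mpr htot) hev

/-- CRT for `3p`: a residue mod `p` and a residue mod `3` have a common representative below `3p`. -/
theorem crt3 (hp : p.Prime) (hp5 : 5 ≤ p) (ξ e : ℕ) (hξ : ξ < p) (he : e < 3) :
    ∃ x : ℕ, x < 3 * p ∧ x % p = ξ ∧ x % 3 = e := by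
  have hcop : Nat.Coprime p 3 := (Nat.coprime_primes hp Nat.prime_three).mpr (by omega)
  obtain ⟨k, hk1, hk2⟩ := Nat.chineseRemainder hcop ξ e
  refine ⟨k % (3 * p), Nat.mod_lt _ (by omega), ?_, ?_⟩
  · rw [Nat.mod_mod_of_dvd k (dvd_mul_left p 3)]
    unfold Nat.ModEq at hk1
    rw [hk1, Nat.mod_eq_of_lt hξ]
  · rw [Nat.mod_mod_of_dvd k (dvd_mul_right 3 p)]
    unfold Nat.ModEq at hk2
    rw [hk2, Nat.mod_eq_of_lt he]

/-! #### C3 The frame of one lifted input and the per-cut status changes -/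

/-- all standing hypotheses about one input `u` of the lifted sub-part (dead row `e`, residue `ξ`). -/
structure Frame (c d₀ : ℕ) (S : TwoStep p n) (w : ZMod p) (u₀ : Fin n → Bool) (τ w3 e : ℕ) (ξ : ZMod p)
    (u : Fin n → Bool) : Prop where
  hp : 1 ≤ p
  lo : d₀ + 3 * p ≤ τ
  hi : τ + d₀ + p + 1 ≤ n
  pin : ∀ t ∈ pinTimes S d₀, t.val ≠ τ
  s0 : S.s 0 ≠ τ
  sl : S.s (Fin.last n) ≠ τ
  mem : u ∈ part S d₀ w u₀
  hw3 : wt u % 3 = w3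
  pat : WinPat n d₀ τ u
  Np : ((wtPrefix u τ : ℕ) : ZMod p) = ξ
  N3 : wtPrefix u τ % 3 = e
  dead : (c + τ + w3 + e) % 3 = 0

namespace Frame

variable {c d₀ : ℕ} {S : TwoStep p n} {w : ZMod p} {u₀ : Fin n → Bool} {τ w3 e : ℕ} {ξ : ZMod p} {u : Fin n → Bool}

/-- the flip position lies inside `[0, n)`. -/
theorem τ_lt (hF : Frame c d₀ S w u₀ τ w3 e ξ u) : τ < n := by
  have := hF.hi; omega

/-- the flip position is positive. -/
theorem one_le (hF : Frame c d₀ S w u₀ τ w3 e ξ u) : 1 ≤ τ := by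
  have := hF.lo; have := hF.hp; omega

/-- the corner flip at `τ` keeps the input in the part (room `p + 1 ≤ τ`, `τ + p < n`, `τ` not a pin time). -/
theorem flip_mem (hF : Frame c d₀ S w u₀ τ w3 e ξ u) : cornerFlip n τ u ∈ part S d₀ w u₀ :=
  cornerFlip_mem_part S d₀ w u₀ τ (by have := hF.lo; have := hF.hp; omega) (by have := hF.hi; have := hF.hp; omega)
    hF.pin u hF.mem

/-- on the part the total weight is the class `w` (mod `p`). -/
theorem Wp (hF : Frame c d₀ S w u₀ τ w3 e ξ u) : ((wt u : ℕ) : ZMod p) = w :=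
  wt_cast_eq_of_mem_part S d₀ w u₀ u hF.mem

/-- window pattern: the bit at `τ − 1` is `true`. -/
theorem bitL (hF : Frame c d₀ S w u₀ τ w3 e ξ u) : u ⟨τ - 1, by have := hF.τ_lt; omega⟩ = true :=
  (hF.pat _ (by simp only; omega) (by simp only; omega)).mpr (by simp only; have := hF.one_le; omega)

/-- window pattern: the bit at `τ` is `false`. -/
theorem bitR (hF : Frame c d₀ S w u₀ τ w3 e ξ u) : u ⟨τ, hF.τ_lt⟩ = false := by
  have h := hF.pat ⟨τ, hF.τ_lt⟩ (by simp only; omega) (by simp only; omega)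
  cases hb : u ⟨τ, hF.τ_lt⟩
  · rfl
  · have := h.mp hb
    simp only at this
    omega

/-- window pattern: `N(τ) = N(s) + 1` for `s < τ ≤ s + d₀ + 1`. -/
theorem N_left (hF : Frame c d₀ S w u₀ τ w3 e ξ u) {s : ℕ} (h1 : s < τ) (h2 : τ ≤ s + d₀ + 1) :
    wtPrefix u τ = wtPrefix u s + 1 :=
  wtPrefix_of_winPat_left hF.pat hF.τ_lt.le h1 h2

/-- window pattern: `N(s) = N(τ)` for `τ ≤ s ≤ τ + d₀ + 1`. -/
theorem N_right (hF : Frame c d₀ S w u₀ τ w3 e ξ u) {s : ℕ} (h1 : τ ≤ s) (h2 : s ≤ τ + d₀ + 1) :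
    wtPrefix u s = wtPrefix u τ :=
  wtPrefix_of_winPat_right hF.pat h1 h2

/-- window pattern: `N(τ) ≥ 1`. -/
theorem N_pos (hF : Frame c d₀ S w u₀ τ w3 e ξ u) : 1 ≤ wtPrefix u τ := by
  have := hF.N_left (s := τ - 1) (by have := hF.one_le; omega) (by omega)
  omega

/-- the corner flip lowers `N(τ)` by exactly one. -/
theorem flipN (hF : Frame c d₀ S w u₀ τ w3 e ξ u) : wtPrefix (cornerFlip n τ u) τ + 1 = wtPrefix u τ :=
  wtPrefix_cornerFlip_self u τ hF.one_le hF.τ_lt hF.bitL hF.bitR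

/-- the corner flip lowers the residue `ξ = N(τ) mod p` by one. -/
theorem flipNp (hF : Frame c d₀ S w u₀ τ w3 e ξ u) : ((wtPrefix (cornerFlip n τ u) τ : ℕ) : ZMod p) = ξ - 1 := by
  rw [eq_sub_iff_add_eq, ← Nat.cast_add_one, hF.flipN, hF.Np]

/-- the own cut is dead (live bit `0`) before the flip … -/
theorem status_own_pre (hF : Frame c d₀ S w u₀ τ w3 e ξ u) (g₀ : Fin (n + 1)) (hg₀ : g₀.val = τ) :
    status c S g₀ u = false := by
  have h3 : (c + g₀.val + walkExp u g₀.val) % 3 = 0 := by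
    unfold walkExp
    rw [hg₀]
    have := hF.hw3; have := hF.N3; have := hF.dead
    omega
  unfold status
  simp [h3]

/-- … and live after it, so its status after the flip is its fire bit. -/
theorem status_own_post (hF : Frame c d₀ S w u₀ τ w3 e ξ u) (g₀ : Fin (n + 1)) (hg₀ : g₀.val = τ) :
    status c S g₀ (cornerFlip n τ u) = S.y g₀ (cornerFlip n τ u) := by
  have h3 : (c + g₀.val + walkExp (cornerFlip n τ u) g₀.val) % 3 ≠ 0 := by
    unfold walkExp
    rw [hg₀, wt_cornerFlip]
    have := hF.hw3; have := hF.N3; have := hF.dead; have := hF.flipN; have := hF.N_pos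
    omega
  unfold status
  simp [h3]

/-- Own cut, fire bit constant on the part: it fires after the flip (effectiveness supplies a firing member). -/
theorem y_own_post_of_const (hF : Frame c d₀ S w u₀ τ w3 e ξ u) (g₀ : Fin (n + 1))
    (hc : ∀ u' ∈ part S d₀ w u₀, ∀ v' ∈ part S d₀ w u₀, S.y g₀ u' = S.y g₀ v')
    {u₁ v₁ : Fin n → Bool} (hu₁ : u₁ ∈ part S d₀ w u₀) (hv₁ : v₁ ∈ part S d₀ w u₀)
    (hne : status c S g₀ u₁ ≠ status c S g₀ v₁) : S.y g₀ (cornerFlip n τ u) = true := by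
  by_cases h1 : status c S g₀ u₁ = true
  · rw [hc _ hF.flip_mem _ hu₁]
    exact ((status_eq_true_iff c S g₀ u₁).mp h1).1
  · have h2 : status c S g₀ v₁ = true := by
      cases hb : status c S g₀ v₁
      · exfalso
        apply hne
        rw [hb]
        simpa using h1
      · rfl
    rw [hc _ hF.flip_mem _ hv₁]
    exact ((status_eq_true_iff c S g₀ v₁).mp h2).1

/-- Own cut, fire bit NOT constant on the part: the cut is near, and after the flip it fires iff `ξ` is THE residue. -/
theorem y_own_post_iff [Fact p.Prime] (hF : Frame c d₀ S w u₀ τ w3 e ξ u) (g₀ : Fin (n + 1)) (hg₀ : g₀.val = τ)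
    (hnc : ¬ ∀ u' ∈ part S d₀ w u₀, ∀ v' ∈ part S d₀ w u₀, S.y g₀ u' = S.y g₀ v') :
    S.y g₀ (cornerFlip n τ u) = true ↔
      ξ ∈ (if τ < S.s g₀ then ({aOf S w g₀} : Finset (ZMod p)) else {aOf S w g₀ + 1}) := by
  push Not at hnc
  obtain ⟨u', hu', v', hv', hne⟩ := hnc
  obtain ⟨hαβ, hs1, hs2, hnear⟩ := near_of_y_nonconst_on_part S d₀ w u₀ g₀ u' v' hu' hv' hne
  have hτ1 := hF.one_le
  have hτn := hF.τ_lt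
  have hlo := hF.lo
  rcases hnear with ⟨-, -, hn1, hn2⟩ | h0 | hn
  · rw [hg₀] at hn1 hn2
    rw [y_eq_decide, decide_eq_true_iff, wt_cornerFlip, hF.Wp]
    rcases lt_trichotomy (S.s g₀) τ with hlt | heq | hgt
    · rw [wtPrefix_cornerFlip τ u (ne_of_lt hlt)]
      have hN : ((wtPrefix u (S.s g₀) : ℕ) : ZMod p) = ξ - 1 := by
        have h := hF.N_left hlt (by omega)
        rw [eq_sub_iff_add_eq, ← Nat.cast_add_one, ← h, hF.Np]
      rw [hN, fire_iff hαβ, sub_eq_iff_eq_add, if_neg (not_lt.mpr hlt.le), Finset.mem_singleton]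
      exact Iff.rfl
    · rw [heq, hF.flipNp, fire_iff hαβ, sub_eq_iff_eq_add, if_neg (lt_irrefl τ), Finset.mem_singleton]
      exact Iff.rfl
    · rw [wtPrefix_cornerFlip τ u (ne_of_gt hgt), hF.N_right hgt.le (by omega), hF.Np, fire_iff hαβ, if_pos hgt,
        Finset.mem_singleton]
      exact Iff.rfl
  · exfalso
    omega
  · exfalso
    omega

/-- Co-observer with a class form (`α = β`): no status change. -/
theorem status_co_eq_of_alpha_eq_beta (hF : Frame c d₀ S w u₀ τ w3 e ξ u) (h : Fin (n + 1)) (hhτ : h.val ≠ τ)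
    (hαβ : S.α h = S.β h) : status c S h (cornerFlip n τ u) = status c S h u := by
  unfold status
  rw [y_const_on_part_of_alpha_eq_beta S d₀ w u₀ h hαβ _ _ hF.flip_mem hF.mem, walkExp_cornerFlip τ u hhτ]

/-- **Co-observer with a genuine form**: the cut is near (else `τ` would be a pin time), its live bit is the constant
`liveC`, and its status changes iff it is live and `ξ ∈ {a_h, a_h + 1}`. -/
theorem status_co_iff [Fact p.Prime] (hF : Frame c d₀ S w u₀ τ w3 e ξ u) (h : Fin (n + 1)) (hhτ : h.val ≠ τ)
    (hs : S.s h = τ) (hαβ : S.α h ≠ S.β h) :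
    status c S h u ≠ status c S h (cornerFlip n τ u) ↔
      (liveC c τ w3 e h.val ∧ ξ ∈ ({aOf S w h, aOf S w h + 1} : Finset (ZMod p))) := by
  have hτ1 := hF.one_le
  have hτn := hF.τ_lt
  have hlo := hF.lo
  have hhi := hF.hi
  -- the co-observer is near
  have hnear : τ < h.val + d₀ ∧ h.val < τ + d₀ := by
    have hnotfar : ¬ Far S d₀ h := by
      intro hfar
      apply hF.pin ⟨S.s h % (n + 1), Nat.mod_lt _ (Nat.succ_pos n)⟩
      · unfold pinTimes
        rw [Finset.mem_image]
        exact ⟨h, by rw [Finset.mem_filter]; exact ⟨Finset.mem_univ _, hfar⟩, rfl⟩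
      · show S.s h % (n + 1) = τ
        rw [hs]
        exact Nat.mod_eq_of_lt (by omega)
    have h0 : h.val ≠ 0 := by
      intro h0
      apply hF.s0
      have : h = 0 := Fin.ext h0
      rw [← this]
      exact hs
    have hn : h.val ≠ n := by
      intro hn
      apply hF.sl
      have : h = Fin.last n := Fin.ext (by rw [hn, Fin.val_last])
      rw [← this]
      exact hs
    unfold Far at hnotfar
    rw [hs] at hnotfar
    have hlt := h.isLt
    by_contra hc
    apply hnotfar
    exact ⟨hαβ, ⟨by omega, by omega⟩, by omega, by omega, by omega⟩
  -- live bit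
  have hlive : ((c + h.val + walkExp u h.val) % 3 ≠ 0) ↔ liveC c τ w3 e h.val := by
    unfold liveC walkExp
    have hw := hF.hw3
    have hN3 := hF.N3
    by_cases hlt : h.val < τ
    · rw [if_pos hlt]
      have := hF.N_left hlt (by omega)
      constructor <;> intro hh <;> omega
    · rw [if_neg hlt]
      have := hF.N_right (s := h.val) (by omega) (by omega)
      constructor <;> intro hh <;> omega
  -- fire bits
  have hfu : S.y h u = decide (ξ = aOf S w h) := by
    rw [y_eq_decide, hs, hF.Wp, hF.Np]
    exact decide_eq_decide.mpr (fire_iff hαβ)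
  have hfv : S.y h (cornerFlip n τ u) = decide (ξ = aOf S w h + 1) := by
    rw [y_eq_decide, hs, wt_cornerFlip, hF.Wp, hF.flipNp]
    exact decide_eq_decide.mpr ((fire_iff hαβ).trans sub_eq_iff_eq_add)
  have hne1 : aOf S w h ≠ aOf S w h + 1 := (succ_ne_self _).symm
  unfold status
  rw [hfu, hfv, walkExp_cornerFlip τ u hhτ]
  rw [show decide ((c + h.val + walkExp u h.val) % 3 ≠ 0) = decide (liveC c τ w3 e h.val)
      from decide_eq_decide.mpr hlive]
  rw [Finset.mem_insert, Finset.mem_singleton]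
  by_cases hL : liveC c τ w3 e h.val
  · rw [decide_eq_true hL]
    by_cases h1 : ξ = aOf S w h
    · have h2 : ¬ ξ = aOf S w h + 1 := fun h2 => hne1 (h1.symm.trans h2)
      rw [decide_eq_true h1, decide_eq_false h2]
      exact iff_of_true (by decide) ⟨hL, Or.inl h1⟩
    · by_cases h2 : ξ = aOf S w h + 1
      · rw [decide_eq_false h1, decide_eq_true h2]
        exact iff_of_true (by decide) ⟨hL, Or.inr h2⟩
      · rw [decide_eq_false h1, decide_eq_false h2]
        exact iff_of_false (by decide) (fun hh => hh.2.elim h1 h2)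
  · rw [decide_eq_false hL]
    exact iff_of_false (by simp) (fun hh => hL hh.1)

end Frame

end Criterion

end DensePeel

end Summit.QuantumAdvantage.AdviceFreeQNC0.LocalEngine
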